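import Literature.NumberTheory.EllipticCurves.ZpExtensionShapiroSetting
import Literature.NumberTheory.EllipticCurves.CastellaGrossiLeeSkinner2022.HeegnerPointKolyvaginSystem
import Literature.NumberTheory.EllipticCurves.Castella2024.LambdaAdicHeegnerClassExistence
import Summits.BirchSwinnertonDyer.BirchSwinnertonDyer.Theorems.UniversalToricDescentTowerNoPTorsion
import HarnessLib
import HarnessLib.Audit.Tags

/-!
# Route `UniversalToricDescent` — light defs module for the promoted stub `KsTwinLambdaAdicAtThree`
# (crux r205 stmt-BirchSwinnertonDyer-24737 `TwinAlgMuZeroAtThree`, line `beta-road`, skeleton v16 sha16 a84e0bb203085cb5)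

Cell `pub/bsd-wall`, LEAD lineage `bsd-wall-utd-p1` (g29), 2026-08-30; `--supports stmt-BirchSwinnertonDyer-24737 --as helper`.
Asked for by the UTD route pen (PEN-RULING-24737-promote-stub-v1, 2026-08-30T10:49:47Z, §2 «BY-NAME default»): the LEAD's
hand-back `promote-stub: stmt-BirchSwinnertonDyer-24737 — stub_ksTwinLambda` is executed by filing ONE new UTD statement item whose
signature is the ONE CONSTANT `KsTwinLambdaAdicAtThree` of this module (so the 3.2 k-char statement with its `letI` binders and
CGLS / Shapiro terms is not pasted into the route file).  This module contains ONLY that `@[conjecture] def … : Prop` (an OPEN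
statement in our theories — human rule 2026-08-15: tagged `@[conjecture]`, an obligation node provable / refutable BY NAME, never a
Literature fact) — the registered
`stub_ksTwinLambda` text of skeleton v16 VERBATIM (= v15 text minus the idle Manin binder `¬ (3 : ℤ) ∣ F.Dt.c →`) — and an
`Iff.rfl` readback lemma against the same text.  ROUTE-INDEPENDENT (imports no `Theses` file: the route file is meant to import
THIS module); no instance, no notation, no theorem content, no `sorry`.

WHAT THE CONSTANT SAYS (K2a‴, RESEARCH, the «KS-twin» in its PRINT SHAPE).  Howard's Thm. 2.3.1 / CGLS Thm. 4.1.1 + Rem. 4.1.4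
READ AT THE MULTIPLICATIVE PRIME `3` for a bucket-B twin `W′` (très-ramifié multiplicative at `3`, `ρ̄₃` onto, conductor `N′`,
`K` imaginary quadratic Heegner for `N′` with odd `d_K`, `κ` anticyclotomic with topological generator `γ`): for a norm-coherent
Heegner family `F` of `W′` (sign `α`, `α² = 1`), a `Λ`-adic Selmer datum `Dat` and the `Λ`-adic Heegner class `z ≠ 0` of `F` in it,
and for every choice of the presentation slots (tame pins `π`, conjugation datum `cd`, residual presentation `πbar`, source H.4
data `Dsrc`): a Kolyvagin system on lit's `Λ`-adic source setting of the twin (`shapiroSettingTame` at the twist `Ψ⁻¹`,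
`S = {v ∣ 3N′}`, `𝓛_E = heegnerKolyvaginPrimes ∖ S`, levels guard) whose bottom class is `Φ′(z)` (`toShapiroSuccLimitH1`).
UNPRINTED at `p ∣ N` (Howard 2004 §2.3 needs `p ∤ N` good ordinary; CGLS 2022 §3.2 `p ∤ 2N`); research · conjecture-class, never
benched as print.  Declaring the constant proves nothing: crux 24737 stays OPEN and BSD is proved for no curve by this file.

References: [Howard2004HeegnerKolyvagin] Thm. 2.3.1, §2.2 Def. 2.2.3–2.2.6, Rem. 1.2.4; [CastellaGrossiLeeSkinner2022] Thm. 4.1.1,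
Rem. 4.1.4, §3.2, §3.4; [BertoliniDarmon1996] §2.5.
-/

noncomputable section

open scoped Classical ContRepresentation TensorProduct NumberField

set_option linter.dupNamespace false -- `…BirchSwinnertonDyer.BirchSwinnertonDyer…` is the cell's nested layout (D-0017)
set_option autoImplicit false

namespace Summit.BirchSwinnertonDyer.BirchSwinnertonDyer.Theorems.UniversalToricDescentKsTwinLambdaDefs

open NumberField IsDedekindDomain Field WeierstrassCurve
open Literature.NumberTheory.EllipticCurves Literature.NumberTheory.EllipticCurves.IwasawaAlgebra
open Literature Literature.NumberTheory.GaloisCohomology Literature.NumberTheory.GaloisCohomology.Howard2004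
open Literature.NumberTheory.GaloisRepresentations Literature.NumberTheory.GaloisRepresentations.DiscreteGaloisModule
open Literature.NumberTheory.EllipticCurves.ZpExtension Literature.NumberTheory.EllipticCurves.CastellaGrossiLeeSkinner2022
open Literature.NumberTheory.EllipticCurves.Castella2024

/-- **`KsTwinLambdaAdicAtThree`** (K2a‴ of line `beta-road` on crux 24737 — the registered stub `stub_ksTwinLambda` of skeleton
v16, sha16 `a84e0bb203085cb5`, VERBATIM as a named `Prop`).  For every bucket-B twin `W′/ℚ` (multiplicative and très ramifié at `3`:
`3 ∤ v₃(Δ′)`; `ρ̄₃` onto; conductor `N′`), every imaginary quadratic `K` Heegner for `N′` with odd discriminant, every anticyclotomic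
`ℤ₃`-extension `κ` with topological generator `γ`, every embedding `jbar`, Heegner family `F` and sign `α` with `α² = 1` and `F`
norm-compatible, every `Λ`-adic Selmer datum `Dat` and `Λ`-adic Heegner class `z ≠ 0` of `F`, and every choice of tame pins `π`,
conjugation datum `cd`, residual presentation `πbar` and source duality data `Dsrc`: there is a Kolyvagin system `κsrc` for the
`Λ`-adic source Selmer setting `W′.shapiroSettingTame (κ.unitTwist (-1)) π …` (levels guard over `heegnerKolyvaginPrimes` off
`placesDividing K (3·N′)`) with `κsrc.one = (W′.toShapiroSuccLimitH1 Dat γ _ z).1`.  Howard 2004 Thm. 2.3.1 / CGLS 2022 Thm. 4.1.1 +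
Rem. 4.1.4 read at `p = 3 ∥ N′` — UNPRINTED there (research · conjecture-class).  A definition only; nothing is proved by it.
[cite: Howard2004HeegnerKolyvagin, Thm. 2.3.1, Rem. 1.2.4 (shape only, at p ∤ N; nothing asserted)] [cite: CastellaGrossiLeeSkinner2022, Thm. 4.1.1, Rem. 4.1.4, §3.2, §3.4 (shape only, at p ∤ 2N; nothing asserted)] [cite: BertoliniDarmon1996, §2.5 (two-term norm relations at p ∣ N)] -/
@[conjecture]
def KsTwinLambdaAdicAtThree : Prop :=
    ∀ (W' : WeierstrassCurve ℚ) [W'.IsElliptic] [W'.IsGloballyMinimal] (N' : ℕ) [NeZero N']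
      (K : Type) [Field K] [NumberField K],
      Rank1Residual.Mult W' 3 → ¬ 3 ∣ padicValInt 3 W'.minimalDiscriminantInt →
      ∀ (hsurj : W'.HasSurjectiveModNGaloisRep 3), ∀ (hN : W'.conductorNorm ℤ = N'), ∀ (hK : IsImaginaryQuadratic K),
      SatisfiesHeegnerHypothesis N' K → Odd (NumberField.discr K) →
      ∀ (κ : ZpExtension K 3), κ.IsAnticyclotomic →
      ∀ (γ : absoluteGaloisGroup K) [hγ : Fact (κ.IsTopGenerator γ)]
        (jbar : AlgebraicClosure K →+* ℂ) (F : HeegnerFamily N' W' K κ jbar) (α : ℤ),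
        α ^ 2 = 1 → F.IsNormCompatible γ α →
      ∀ (Dat : (W'.baseChange K).LambdaAdicSelmerData κ γ) (z : Dat.S),
        IsLambdaAdicHeegnerClass Dat F α z → z ≠ 0 →
      ∀ (π : ∀ v : HeightOneSpectrum (𝓞 K), TamePin v) (cd : ConjugationDatum K)
        (πbar : letI := W'.shapiroResidueModule K 3
          ∀ j, W'.ShapiroLevel K 3 j →ₗ[IwasawaAlgebra 3 ⧸ shapiroIdeal 3 (j + 1)] geomTorsion (W'.baseChange K) ((3 : ℕ) : ℤ))
        (Dsrc : ∀ j, DualityDatum 3 cd ((W'.shapiroTower K 3 (κ.unitTwist (-1))).ρ j) (IwasawaAlgebra 3 ⧸ shapiroIdeal 3 (j + 1))),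
        letI := W'.shapiroResidueModule K 3
        ∃ κsrc : (W'.shapiroSettingTame (κ.unitTwist (-1)) π
        (fun n v ↦ n ∈ levels (CastellaGrossiLeeSkinner2022.heegnerKolyvaginPrimes W' (κ.unitTwist (-1))
          (CastellaGrossiLeeSkinner2022.placesDividing K (3 * N') CastellaGrossiLeeSkinner2022.mul_level_ne_zero)) ∧ v ∈ n)
        (W'.shapiroTameHyp_of_mem_levels (κ.unitTwist (-1))
          (CastellaGrossiLeeSkinner2022.placesDividing K (3 * N') CastellaGrossiLeeSkinner2022.mul_level_ne_zero)
          (fun _ hv ↦ CastellaGrossiLeeSkinner2022.mem_placesDividing_of_dvd CastellaGrossiLeeSkinner2022.mul_level_ne_zero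
            (dvd_mul_right 3 N') hv)
          (fun _ hv _ ↦ CastellaGrossiLeeSkinner2022.hasGoodReductionAt_of_not_mem_placesDividing W' hN.symm
            CastellaGrossiLeeSkinner2022.mul_level_ne_zero hv)
          (CastellaGrossiLeeSkinner2022.heegnerKolyvaginPrimes W' (κ.unitTwist (-1))
            (CastellaGrossiLeeSkinner2022.placesDividing K (3 * N') CastellaGrossiLeeSkinner2022.mul_level_ne_zero))
          (CastellaGrossiLeeSkinner2022.heegnerKolyvaginPrimes_subset_degreeTwoPrimes W' (κ.unitTwist (-1)) _)
          (fun _ hv ↦ CastellaGrossiLeeSkinner2022.not_mem_of_mem_heegnerKolyvaginPrimes W' (κ.unitTwist (-1)) _ hv))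
        (CastellaGrossiLeeSkinner2022.placesDividing K (3 * N') CastellaGrossiLeeSkinner2022.mul_level_ne_zero)
        (fun _ hv ↦ CastellaGrossiLeeSkinner2022.mem_placesDividing_of_dvd CastellaGrossiLeeSkinner2022.mul_level_ne_zero
          (dvd_mul_right 3 N') hv)
        (fun _ hv _ ↦ CastellaGrossiLeeSkinner2022.hasGoodReductionAt_of_not_mem_placesDividing W' hN.symm
          CastellaGrossiLeeSkinner2022.mul_level_ne_zero hv)
        (CastellaGrossiLeeSkinner2022.heegnerKolyvaginPrimes W' (κ.unitTwist (-1))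
          (CastellaGrossiLeeSkinner2022.placesDividing K (3 * N') CastellaGrossiLeeSkinner2022.mul_level_ne_zero))
        (CastellaGrossiLeeSkinner2022.heegnerKolyvaginPrimes_subset_degreeTwoPrimes W' (κ.unitTwist (-1)) _)
        (fun _ hv ↦ CastellaGrossiLeeSkinner2022.not_mem_of_mem_heegnerKolyvaginPrimes W' (κ.unitTwist (-1)) _ hv)
        jbar cd πbar Dsrc).KolyvaginSystem,
          κsrc.one = (W'.toShapiroSuccLimitH1 Dat hγ.out (Summit.BirchSwinnertonDyer.BirchSwinnertonDyer.Theorems.UniversalToricDescentTowerTorsion.baseChange_noPTorsion_of_surjective W' 3 hsurj K hK) z).1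

/-- **Readback** (`Iff.rfl`): `KsTwinLambdaAdicAtThree` unfolds to the registered `stub_ksTwinLambda` text of skeleton v16
(sha16 `a84e0bb203085cb5`) literally — the statement the route item is meant to carry BY NAME is this one and no other.
[cite: Howard2004HeegnerKolyvagin, Thm. 2.3.1] -/
theorem ksTwinLambdaAdicAtThree_iff :
    KsTwinLambdaAdicAtThree ↔
    ∀ (W' : WeierstrassCurve ℚ) [W'.IsElliptic] [W'.IsGloballyMinimal] (N' : ℕ) [NeZero N']
      (K : Type) [Field K] [NumberField K],
      Rank1Residual.Mult W' 3 → ¬ 3 ∣ padicValInt 3 W'.minimalDiscriminantInt →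
      ∀ (hsurj : W'.HasSurjectiveModNGaloisRep 3), ∀ (hN : W'.conductorNorm ℤ = N'), ∀ (hK : IsImaginaryQuadratic K),
      SatisfiesHeegnerHypothesis N' K → Odd (NumberField.discr K) →
      ∀ (κ : ZpExtension K 3), κ.IsAnticyclotomic →
      ∀ (γ : absoluteGaloisGroup K) [hγ : Fact (κ.IsTopGenerator γ)]
        (jbar : AlgebraicClosure K →+* ℂ) (F : HeegnerFamily N' W' K κ jbar) (α : ℤ),
        α ^ 2 = 1 → F.IsNormCompatible γ α →
      ∀ (Dat : (W'.baseChange K).LambdaAdicSelmerData κ γ) (z : Dat.S),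
        IsLambdaAdicHeegnerClass Dat F α z → z ≠ 0 →
      ∀ (π : ∀ v : HeightOneSpectrum (𝓞 K), TamePin v) (cd : ConjugationDatum K)
        (πbar : letI := W'.shapiroResidueModule K 3
          ∀ j, W'.ShapiroLevel K 3 j →ₗ[IwasawaAlgebra 3 ⧸ shapiroIdeal 3 (j + 1)] geomTorsion (W'.baseChange K) ((3 : ℕ) : ℤ))
        (Dsrc : ∀ j, DualityDatum 3 cd ((W'.shapiroTower K 3 (κ.unitTwist (-1))).ρ j) (IwasawaAlgebra 3 ⧸ shapiroIdeal 3 (j + 1))),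
        letI := W'.shapiroResidueModule K 3
        ∃ κsrc : (W'.shapiroSettingTame (κ.unitTwist (-1)) π
        (fun n v ↦ n ∈ levels (CastellaGrossiLeeSkinner2022.heegnerKolyvaginPrimes W' (κ.unitTwist (-1))
          (CastellaGrossiLeeSkinner2022.placesDividing K (3 * N') CastellaGrossiLeeSkinner2022.mul_level_ne_zero)) ∧ v ∈ n)
        (W'.shapiroTameHyp_of_mem_levels (κ.unitTwist (-1))
          (CastellaGrossiLeeSkinner2022.placesDividing K (3 * N') CastellaGrossiLeeSkinner2022.mul_level_ne_zero)
          (fun _ hv ↦ CastellaGrossiLeeSkinner2022.mem_placesDividing_of_dvd CastellaGrossiLeeSkinner2022.mul_level_ne_zero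
            (dvd_mul_right 3 N') hv)
          (fun _ hv _ ↦ CastellaGrossiLeeSkinner2022.hasGoodReductionAt_of_not_mem_placesDividing W' hN.symm
            CastellaGrossiLeeSkinner2022.mul_level_ne_zero hv)
          (CastellaGrossiLeeSkinner2022.heegnerKolyvaginPrimes W' (κ.unitTwist (-1))
            (CastellaGrossiLeeSkinner2022.placesDividing K (3 * N') CastellaGrossiLeeSkinner2022.mul_level_ne_zero))
          (CastellaGrossiLeeSkinner2022.heegnerKolyvaginPrimes_subset_degreeTwoPrimes W' (κ.unitTwist (-1)) _)
          (fun _ hv ↦ CastellaGrossiLeeSkinner2022.not_mem_of_mem_heegnerKolyvaginPrimes W' (κ.unitTwist (-1)) _ hv))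
        (CastellaGrossiLeeSkinner2022.placesDividing K (3 * N') CastellaGrossiLeeSkinner2022.mul_level_ne_zero)
        (fun _ hv ↦ CastellaGrossiLeeSkinner2022.mem_placesDividing_of_dvd CastellaGrossiLeeSkinner2022.mul_level_ne_zero
          (dvd_mul_right 3 N') hv)
        (fun _ hv _ ↦ CastellaGrossiLeeSkinner2022.hasGoodReductionAt_of_not_mem_placesDividing W' hN.symm
          CastellaGrossiLeeSkinner2022.mul_level_ne_zero hv)
        (CastellaGrossiLeeSkinner2022.heegnerKolyvaginPrimes W' (κ.unitTwist (-1))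
          (CastellaGrossiLeeSkinner2022.placesDividing K (3 * N') CastellaGrossiLeeSkinner2022.mul_level_ne_zero))
        (CastellaGrossiLeeSkinner2022.heegnerKolyvaginPrimes_subset_degreeTwoPrimes W' (κ.unitTwist (-1)) _)
        (fun _ hv ↦ CastellaGrossiLeeSkinner2022.not_mem_of_mem_heegnerKolyvaginPrimes W' (κ.unitTwist (-1)) _ hv)
        jbar cd πbar Dsrc).KolyvaginSystem,
          κsrc.one = (W'.toShapiroSuccLimitH1 Dat hγ.out (Summit.BirchSwinnertonDyer.BirchSwinnertonDyer.Theorems.UniversalToricDescentTowerTorsion.baseChange_noPTorsion_of_surjective W' 3 hsurj K hK) z).1 :=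
  Iff.rfl

end Summit.BirchSwinnertonDyer.BirchSwinnertonDyer.Theorems.UniversalToricDescentKsTwinLambdaDefs

end
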